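import Mathlib
import Literature.Geometry.Lorentzian.Basic
import Literature.Analysis.FunctionSpaces.ParametricIntegralSmooth
import Summits.FinalStateConjecture.FinalStateConjecture.Theorems.StarvedNecksNecksCertifyStubSphereMeanDarbouxHelpers

/-!
# Route StarvedNecks — crux `NecksCertify`, line `two-cap-focusing-ledger`: rung R1a-i

Stub `stub_sphereMeanDarboux` (statement `SphereMeanDarboux` of the line skeleton, verbatim):
**Darboux's equation for spherical means on `E3 = ℝ³`** (Evans, *PDE*, §2.4.1, Lemma 1;
Courant–Hilbert II, Ch. VI §13).  For `f ∈ C^∞(E3)` and a centre `x`, with the un-normalised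
spherical mean `M(ρ) = ∫_{S²} f(x + ρw) dσ(w)` (`σ = volume.toSphere`, all real `ρ`):

* `M` is `C^∞` (smooth parametric integral over the compact sphere, tree
  `Literature.Analysis.FunctionSpaces.contDiff_parametric_integral`);
* `M'(ρ) = ∫ Df(x + ρw)(w) dσ` and `M''(ρ) = ∫ D²f(x + ρw)(w, w) dσ` (differentiation under the
  integral sign, `hasDerivAt_sphereMean`, `hasDerivAt_sphereMean_fderiv`);
* DARBOUX: `(ρM)''(r) = r ∫ Δf(x + rw) dσ`.  From the helper file's
  `integral_laplacian_toSphere` (`∫_{S²} Δh = ∫_{S²} [D²h(w)(w,w) + 2Dh(w)(w)]`, proved by rotation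
  invariance of `σ`) applied to `h = f(x + ρ·)` one gets `ρ² ∫Δf(x + ρ·) = ρ² M'' + 2ρ M'`
  (`sphereMean_darboux_sq`); with `(ρM)'' = 2M' + ρM''` this is the claim for `r ≠ 0`, and at
  `r = 0` both sides vanish (`M'(0) = ∫ Df(x)(w) dσ = 0` by antipodal symmetry).

Mathlib + the helper file + `ParametricIntegralSmooth`; no named facts.
-/

noncomputable section

open scoped Manifold ContDiff Topology ENNReal RealInnerProductSpace
open Filter Set MeasureTheory Topology Literature.Geometry.Lorentzian NormedSpace

namespace Summit.FinalStateConjecture.FinalStateConjecture.Theorems.NecksCertifyTwoCap.Darboux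

/-! ### Calculus of the dilated function `y ↦ f (x + ρ y)` -/

/-- Directional derivatives of a partial application of the derivative:
`D[z ↦ Df(z) v](y) u = D²f(y)(u)(v)`. [folklore] -/
theorem fderiv_fderiv_apply_const {f : E3 → ℝ} {y : E3}
    (hf : DifferentiableAt ℝ (fderiv ℝ f) y) (u v : E3) :
    fderiv ℝ (fun z ↦ fderiv ℝ f z v) y u = fderiv ℝ (fderiv ℝ f) y u v := by
  rw [fderiv_clm_apply hf (differentiableAt_const v), fderiv_const_apply]
  simp

/-- Chain rule through the dilation `y ↦ x + ρ y`:
`D[y ↦ φ (x + ρ y)](w) u = ρ Dφ(x + ρ w) u`. [folklore] -/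
theorem fderiv_comp_dilation_apply {φ : E3 → ℝ} (hφ : Differentiable ℝ φ) (x : E3) (ρ : ℝ)
    (w u : E3) :
    fderiv ℝ (fun y ↦ φ (x + ρ • y)) w u = ρ * fderiv ℝ φ (x + ρ • w) u := by
  have haff : HasFDerivAt (fun y : E3 ↦ x + ρ • y) (ρ • ContinuousLinearMap.id ℝ E3) w :=
    ((hasFDerivAt_id w).const_smul ρ).const_add x
  have h : HasFDerivAt (fun y ↦ φ (x + ρ • y))
      ((fderiv ℝ φ (x + ρ • w)).comp (ρ • ContinuousLinearMap.id ℝ E3)) w :=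
    (hφ (x + ρ • w)).hasFDerivAt.comp w haff
  rw [h.fderiv, ContinuousLinearMap.comp_apply,
    show (ρ • ContinuousLinearMap.id ℝ E3) u = ρ • u from rfl, map_smul, smul_eq_mul]

/-- Second derivatives through the dilation: `D²[y ↦ f (x + ρ y)](w)(u)(v) = ρ² D²f(x + ρ w)(u)(v)`
for `f ∈ C^∞`. [folklore] -/
theorem fderiv_fderiv_comp_dilation_apply {f : E3 → ℝ} (hf : ContDiff ℝ ∞ f) (x : E3) (ρ : ℝ)
    (w u v : E3) :
    fderiv ℝ (fderiv ℝ (fun y ↦ f (x + ρ • y))) w u v =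
      ρ ^ 2 * fderiv ℝ (fderiv ℝ f) (x + ρ • w) u v := by
  have htop : (∞ : WithTop ℕ∞) ≠ 0 := by exact_mod_cast WithTop.coe_ne_zero.2 (by decide)
  have hfd : Differentiable ℝ f := hf.differentiable htop
  have hDf : Differentiable ℝ (fderiv ℝ f) := (hf.fderiv_right (m := ∞) le_rfl).differentiable htop
  have hh : ContDiff ℝ ∞ (fun y ↦ f (x + ρ • y)) :=
    hf.comp (contDiff_const.add (contDiff_const_smul ρ))
  have hDh : Differentiable ℝ (fderiv ℝ (fun y ↦ f (x + ρ • y))) :=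
    (hh.fderiv_right (m := ∞) le_rfl).differentiable htop
  rw [← fderiv_fderiv_apply_const (hDh w) u v]
  have hfun : (fun z ↦ fderiv ℝ (fun y ↦ f (x + ρ • y)) z v) =
      fun z ↦ ρ * (fun y ↦ fderiv ℝ f y v) (x + ρ • z) := by
    funext z
    exact fderiv_comp_dilation_apply hfd x ρ z v
  have hg : Differentiable ℝ (fun y ↦ fderiv ℝ f y v) := hDf.clm_apply (differentiable_const v)
  have hgz : DifferentiableAt ℝ (fun z ↦ (fun y ↦ fderiv ℝ f y v) (x + ρ • z)) w :=
    (hg (x + ρ • w)).comp w ((differentiableAt_id.const_smul ρ).const_add x)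
  rw [hfun, fderiv_const_mul hgz, FunLike.coe_smul, Pi.smul_apply, smul_eq_mul,
    fderiv_comp_dilation_apply hg x ρ w u, fderiv_fderiv_apply_const (hDf _) u v]
  ring

/-! ### Differentiation of the spherical means under the integral sign -/

/-- **First derivative of the spherical mean**: `M(ρ) = ∫ f(x + ρw) dσ` is differentiable with
`M'(ρ) = ∫ Df(x + ρw)(w) dσ` (differentiation under the integral sign over the compact sphere,
tree `hasFDerivAt_parametric_integral`). [folklore] -/
theorem hasDerivAt_sphereMean {f : E3 → ℝ} (hf : ContDiff ℝ ∞ f) (x : E3) (ρ : ℝ) :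
    HasDerivAt (fun ρ : ℝ ↦ ∫ w : Metric.sphere (0 : E3) 1, f (x + ρ • (w : E3))
        ∂((volume : Measure E3).toSphere))
      (∫ w : Metric.sphere (0 : E3) 1, fderiv ℝ f (x + ρ • (w : E3)) (w : E3)
        ∂((volume : Measure E3).toSphere)) ρ := by
  have htop : (∞ : WithTop ℕ∞) ≠ 0 := by exact_mod_cast WithTop.coe_ne_zero.2 (by decide)
  have hG : ContDiff ℝ ∞ (fun q : E3 × ℝ ↦ f (x + q.2 • q.1)) :=
    hf.comp (contDiff_const.add (contDiff_snd.smul contDiff_fst))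
  have hK := isCompact_sphere (0 : E3) (1 : ℝ)
  have hmem : ∀ᵐ w ∂((volume : Measure E3).toSphere),
      ((w : Metric.sphere (0 : E3) 1) : E3) ∈ Metric.sphere (0 : E3) 1 := ae_of_all _ fun w ↦ w.2
  have hdiff : Differentiable ℝ (fun ρ : ℝ ↦ ∫ w : Metric.sphere (0 : E3) 1,
      f (x + ρ • (w : E3)) ∂((volume : Measure E3).toSphere)) :=
    Literature.Analysis.FunctionSpaces.differentiable_parametric_integral
      (μ := (volume : Measure E3).toSphere) measurable_subtype_coe hK hmem hG htop
  have happ := Literature.Analysis.FunctionSpaces.fderiv_parametric_integral_apply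
      (μ := (volume : Measure E3).toSphere) measurable_subtype_coe hK hmem hG htop ρ 1
  -- identify the integrand of the derivative
  have hpt : ∀ y : E3, fderiv ℝ (fun q : E3 × ℝ ↦ f (x + q.2 • q.1)) (y, ρ) ((0 : E3), (1 : ℝ)) =
      fderiv ℝ f (x + ρ • y) y := by
    intro y
    have hd1 : HasDerivAt (fun s : ℝ ↦ (fun q : E3 × ℝ ↦ f (x + q.2 • q.1)) (y, s))
        (fderiv ℝ (fun q : E3 × ℝ ↦ f (x + q.2 • q.1)) (y, ρ) ((0 : E3), (1 : ℝ))) ρ :=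
      ((hG.differentiable htop) (y, ρ)).hasFDerivAt.comp_hasDerivAt ρ
        ((hasDerivAt_const ρ y).prodMk (hasDerivAt_id ρ))
    have haff : HasDerivAt (fun s : ℝ ↦ x + s • y) y ρ := by
      simpa using ((hasDerivAt_id ρ).smul_const y).const_add x
    have hd2 : HasDerivAt (fun s : ℝ ↦ (fun q : E3 × ℝ ↦ f (x + q.2 • q.1)) (y, s))
        (fderiv ℝ f (x + ρ • y) y) ρ :=
      ((hf.differentiable htop) (x + ρ • y)).hasFDerivAt.comp_hasDerivAt ρ haff
    exact hd1.unique hd2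
  have hderiv : deriv (fun ρ : ℝ ↦ ∫ w : Metric.sphere (0 : E3) 1, f (x + ρ • (w : E3))
      ∂((volume : Measure E3).toSphere)) ρ = ∫ w : Metric.sphere (0 : E3) 1,
        fderiv ℝ f (x + ρ • (w : E3)) (w : E3) ∂((volume : Measure E3).toSphere) := by
    rw [← fderiv_apply_one_eq_deriv]
    beta_reduce at happ
    rw [happ]
    exact integral_congr_ae (ae_of_all _ fun w ↦ hpt w)
  exact hderiv ▸ (hdiff ρ).hasDerivAt

/-- **Second derivative of the spherical mean**: `ρ ↦ ∫ Df(x + ρw)(w) dσ` is differentiable with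
derivative `∫ D²f(x + ρw)(w, w) dσ`. [folklore] -/
theorem hasDerivAt_sphereMean_fderiv {f : E3 → ℝ} (hf : ContDiff ℝ ∞ f) (x : E3) (ρ : ℝ) :
    HasDerivAt (fun ρ : ℝ ↦ ∫ w : Metric.sphere (0 : E3) 1, fderiv ℝ f (x + ρ • (w : E3)) (w : E3)
        ∂((volume : Measure E3).toSphere))
      (∫ w : Metric.sphere (0 : E3) 1, fderiv ℝ (fderiv ℝ f) (x + ρ • (w : E3)) (w : E3) (w : E3)
        ∂((volume : Measure E3).toSphere)) ρ := by
  have htop : (∞ : WithTop ℕ∞) ≠ 0 := by exact_mod_cast WithTop.coe_ne_zero.2 (by decide)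
  have hDf : ContDiff ℝ ∞ (fderiv ℝ f) := hf.fderiv_right (m := ∞) le_rfl
  have hG : ContDiff ℝ ∞ (fun q : E3 × ℝ ↦ fderiv ℝ f (x + q.2 • q.1) q.1) :=
    (hDf.comp (contDiff_const.add (contDiff_snd.smul contDiff_fst))).clm_apply contDiff_fst
  have hK := isCompact_sphere (0 : E3) (1 : ℝ)
  have hmem : ∀ᵐ w ∂((volume : Measure E3).toSphere),
      ((w : Metric.sphere (0 : E3) 1) : E3) ∈ Metric.sphere (0 : E3) 1 := ae_of_all _ fun w ↦ w.2
  have hdiff : Differentiable ℝ (fun ρ : ℝ ↦ ∫ w : Metric.sphere (0 : E3) 1,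
      fderiv ℝ f (x + ρ • (w : E3)) (w : E3) ∂((volume : Measure E3).toSphere)) :=
    Literature.Analysis.FunctionSpaces.differentiable_parametric_integral
      (μ := (volume : Measure E3).toSphere) measurable_subtype_coe hK hmem hG htop
  have happ := Literature.Analysis.FunctionSpaces.fderiv_parametric_integral_apply
      (μ := (volume : Measure E3).toSphere) measurable_subtype_coe hK hmem hG htop ρ 1
  have hpt : ∀ y : E3,
      fderiv ℝ (fun q : E3 × ℝ ↦ fderiv ℝ f (x + q.2 • q.1) q.1) (y, ρ) ((0 : E3), (1 : ℝ)) =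
      fderiv ℝ (fderiv ℝ f) (x + ρ • y) y y := by
    intro y
    have hd1 : HasDerivAt (fun s : ℝ ↦ (fun q : E3 × ℝ ↦ fderiv ℝ f (x + q.2 • q.1) q.1) (y, s))
        (fderiv ℝ (fun q : E3 × ℝ ↦ fderiv ℝ f (x + q.2 • q.1) q.1) (y, ρ) ((0 : E3), (1 : ℝ)))
        ρ :=
      ((hG.differentiable htop) (y, ρ)).hasFDerivAt.comp_hasDerivAt ρ
        ((hasDerivAt_const ρ y).prodMk (hasDerivAt_id ρ))
    have haff : HasDerivAt (fun s : ℝ ↦ x + s • y) y ρ := by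
      simpa using ((hasDerivAt_id ρ).smul_const y).const_add x
    have hc : HasDerivAt (fun s : ℝ ↦ fderiv ℝ f (x + s • y))
        (fderiv ℝ (fderiv ℝ f) (x + ρ • y) y) ρ :=
      ((hDf.differentiable htop) (x + ρ • y)).hasFDerivAt.comp_hasDerivAt ρ haff
    have hd2 : HasDerivAt (fun s : ℝ ↦ (fun q : E3 × ℝ ↦ fderiv ℝ f (x + q.2 • q.1) q.1) (y, s))
        (fderiv ℝ (fderiv ℝ f) (x + ρ • y) y y) ρ := by
      have := hc.clm_apply (hasDerivAt_const ρ y)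
      simpa using this
    exact hd1.unique hd2
  have hderiv : deriv (fun ρ : ℝ ↦ ∫ w : Metric.sphere (0 : E3) 1,
      fderiv ℝ f (x + ρ • (w : E3)) (w : E3) ∂((volume : Measure E3).toSphere)) ρ =
      ∫ w : Metric.sphere (0 : E3) 1, fderiv ℝ (fderiv ℝ f) (x + ρ • (w : E3)) (w : E3) (w : E3)
        ∂((volume : Measure E3).toSphere) := by
    rw [← fderiv_apply_one_eq_deriv]
    beta_reduce at happ
    rw [happ]
    exact integral_congr_ae (ae_of_all _ fun w ↦ hpt w)
  exact hderiv ▸ (hdiff ρ).hasDerivAt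

/-- `(ρ M)'' = 2 M' + ρ M''` for a twice differentiable `M`. [folklore] -/
theorem iteratedDeriv_two_id_mul {M M₁ M₂ : ℝ → ℝ} (h1 : ∀ ρ, HasDerivAt M (M₁ ρ) ρ)
    (h2 : ∀ ρ, HasDerivAt M₁ (M₂ ρ) ρ) (r : ℝ) :
    iteratedDeriv 2 (fun ρ ↦ ρ * M ρ) r = 2 * M₁ r + r * M₂ r := by
  have hF1 : deriv (fun ρ ↦ ρ * M ρ) = fun ρ ↦ M ρ + ρ * M₁ ρ := by
    funext ρ
    have h : HasDerivAt (fun ρ ↦ ρ * M ρ) (1 * M ρ + ρ * M₁ ρ) ρ := (hasDerivAt_id' ρ).mul (h1 ρ)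
    rw [h.deriv]
    ring
  have h' : HasDerivAt (fun ρ ↦ M ρ + ρ * M₁ ρ) (M₁ r + (1 * M₁ r + r * M₂ r)) r :=
    (h1 r).add ((hasDerivAt_id' r).mul (h2 r))
  rw [iteratedDeriv_succ, iteratedDeriv_one, hF1, h'.deriv]
  ring

/-! ### Darboux's equation -/

/-- **The spherical means kill odd functions at the centre**: `∫ Df(x)(w) dσ(w) = 0` (antipodal
symmetry of `σ`). [folklore] -/
theorem integral_fderiv_centre_eq_zero (f : E3 → ℝ) (x : E3) :
    ∫ w : Metric.sphere (0 : E3) 1, fderiv ℝ f x (w : E3) ∂((volume : Measure E3).toSphere) = 0 := by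
  have h := integral_comp_neg_toSphere (fun y : E3 ↦ fderiv ℝ f x y)
  simp only [map_neg, integral_neg] at h
  linarith

/-- **Darboux's identity, squared form**: for `f ∈ C^∞`, all `x` and all real `ρ`,
`ρ² ∫ Δf(x + ρw) dσ = ρ² ∫ D²f(x + ρw)(w, w) dσ + 2ρ ∫ Df(x + ρw)(w) dσ`
(`integral_laplacian_toSphere` for `h = f(x + ρ ·)` and the chain rule). [folklore] -/
theorem sphereMean_darboux_sq {f : E3 → ℝ} (hf : ContDiff ℝ ∞ f) (x : E3) (ρ : ℝ) :
    ρ ^ 2 * ∫ w : Metric.sphere (0 : E3) 1, (∑ i : Fin 3,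
        fderiv ℝ (fun z ↦ fderiv ℝ f z (EuclideanSpace.single i (1 : ℝ))) (x + ρ • (w : E3))
          (EuclideanSpace.single i (1 : ℝ))) ∂((volume : Measure E3).toSphere) =
      ρ ^ 2 * ∫ w : Metric.sphere (0 : E3) 1, fderiv ℝ (fderiv ℝ f) (x + ρ • (w : E3)) (w : E3)
        (w : E3) ∂((volume : Measure E3).toSphere) +
      2 * ρ * ∫ w : Metric.sphere (0 : E3) 1, fderiv ℝ f (x + ρ • (w : E3)) (w : E3)
        ∂((volume : Measure E3).toSphere) := by
  have htop : (∞ : WithTop ℕ∞) ≠ 0 := by exact_mod_cast WithTop.coe_ne_zero.2 (by decide)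
  have hfd : Differentiable ℝ f := hf.differentiable htop
  have hDfs : ContDiff ℝ ∞ (fderiv ℝ f) := hf.fderiv_right (m := ∞) le_rfl
  have hDf : Differentiable ℝ (fderiv ℝ f) := hDfs.differentiable htop
  have hc1 : Continuous (fderiv ℝ f) := hf.continuous_fderiv htop
  have hc2 : Continuous (fderiv ℝ (fderiv ℝ f)) := hDfs.continuous_fderiv htop
  have hh2 : ContDiff ℝ 2 (fun y ↦ f (x + ρ • y)) :=
    (hf.of_le (WithTop.coe_le_coe.2 le_top)).comp (contDiff_const.add (contDiff_const_smul ρ))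
  have hlap := integral_laplacian_toSphere hh2
  have hL : ∀ w : Metric.sphere (0 : E3) 1, (∑ i : Fin 3,
      fderiv ℝ (fderiv ℝ (fun y ↦ f (x + ρ • y))) w (EuclideanSpace.single i (1 : ℝ))
        (EuclideanSpace.single i (1 : ℝ))) =
      ρ ^ 2 * ∑ i : Fin 3, fderiv ℝ (fun z ↦ fderiv ℝ f z (EuclideanSpace.single i (1 : ℝ)))
        (x + ρ • (w : E3)) (EuclideanSpace.single i (1 : ℝ)) := by
    intro w
    rw [Finset.mul_sum]
    refine Finset.sum_congr rfl fun i _ ↦ ?_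
    rw [fderiv_fderiv_comp_dilation_apply hf, fderiv_fderiv_apply_const (hDf _)]
  have hR : ∀ w : Metric.sphere (0 : E3) 1,
      fderiv ℝ (fderiv ℝ (fun y ↦ f (x + ρ • y))) w w w + 2 * fderiv ℝ (fun y ↦ f (x + ρ • y)) w w
      = ρ ^ 2 * fderiv ℝ (fderiv ℝ f) (x + ρ • (w : E3)) w w +
        2 * ρ * fderiv ℝ f (x + ρ • (w : E3)) w := by
    intro w
    rw [fderiv_fderiv_comp_dilation_apply hf, fderiv_comp_dilation_apply hfd]
    ring
  have hint2 : Integrable (fun w : Metric.sphere (0 : E3) 1 ↦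
      ρ ^ 2 * fderiv ℝ (fderiv ℝ f) (x + ρ • (w : E3)) w w) ((volume : Measure E3).toSphere) :=
    integrable_toSphere_of_continuous (by fun_prop)
  have hint1 : Integrable (fun w : Metric.sphere (0 : E3) 1 ↦
      2 * ρ * fderiv ℝ f (x + ρ • (w : E3)) w) ((volume : Measure E3).toSphere) :=
    integrable_toSphere_of_continuous (by fun_prop)
  rw [integral_congr_ae (ae_of_all _ hL), integral_congr_ae (ae_of_all _ hR), integral_const_mul,
    integral_add hint2 hint1, integral_const_mul, integral_const_mul] at hlap
  exact hlap

/-- **Registered stub R1a-i** (`SphereMeanDarboux`, verbatim): Darboux's equation for spherical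
means on `E3` — smoothness of `M(ρ) = ∫_{S²} f(x + ρw) dσ(w)`, `M'(ρ) = ∫ Df(x + ρw)(w) dσ`, and
`(ρ M)''(r) = r ∫ Δf(x + rw) dσ` (Evans, *PDE*, §2.4.1, Lemma 1; Courant–Hilbert II, Ch. VI
§13).  Proof: `(ρM)'' = 2M' + ρM''` with `M'' = ∫ D²f(x + ρw)(w, w) dσ`; the squared identity
`ρ²∫Δf = ρ² M'' + 2ρ M'` (`sphereMean_darboux_sq`) gives the claim for `r ≠ 0`, and at `r = 0`
both sides vanish since `M'(0) = ∫ Df(x)(w) dσ = 0` by antipodal symmetry. [folklore] -/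
theorem stub_sphereMeanDarboux :
  ∀ (f : E3 → ℝ), ContDiff ℝ ∞ f → ∀ (x : E3),
    ContDiff ℝ ∞ (fun ρ : ℝ ↦ ∫ (w : Metric.sphere (0 : E3) 1), f (x + ρ • (w : E3)) ∂((volume : Measure E3).toSphere)) ∧
    (∀ r : ℝ, deriv (fun ρ : ℝ ↦ ∫ (w : Metric.sphere (0 : E3) 1), f (x + ρ • (w : E3)) ∂((volume : Measure E3).toSphere)) r =
      ∫ (w : Metric.sphere (0 : E3) 1), fderiv ℝ f (x + r • (w : E3)) (w : E3) ∂((volume : Measure E3).toSphere)) ∧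
    (∀ r : ℝ, iteratedDeriv 2 (fun ρ : ℝ ↦ ρ * ∫ (w : Metric.sphere (0 : E3) 1), f (x + ρ • (w : E3)) ∂((volume : Measure E3).toSphere)) r =
      r * ∫ (w : Metric.sphere (0 : E3) 1), (∑ i : Fin 3, fderiv ℝ (fun z ↦ fderiv ℝ f z (EuclideanSpace.single i (1 : ℝ)))
        (x + r • (w : E3)) (EuclideanSpace.single i (1 : ℝ))) ∂((volume : Measure E3).toSphere)) := by
  intro f hf x
  have hG : ContDiff ℝ ∞ (fun q : E3 × ℝ ↦ f (x + q.2 • q.1)) :=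
    hf.comp (contDiff_const.add (contDiff_snd.smul contDiff_fst))
  have hmem : ∀ᵐ w ∂((volume : Measure E3).toSphere),
      ((w : Metric.sphere (0 : E3) 1) : E3) ∈ Metric.sphere (0 : E3) 1 := ae_of_all _ fun w ↦ w.2
  refine ⟨Literature.Analysis.FunctionSpaces.contDiff_parametric_integral
      (μ := (volume : Measure E3).toSphere) measurable_subtype_coe (isCompact_sphere (0 : E3) 1)
      hmem hG, fun r ↦ (hasDerivAt_sphereMean hf x r).deriv, fun r ↦ ?_⟩
  rw [iteratedDeriv_two_id_mul (hasDerivAt_sphereMean hf x) (hasDerivAt_sphereMean_fderiv hf x) r]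
  have hD := sphereMean_darboux_sq hf x r
  rcases eq_or_ne r 0 with hr | hr
  · subst hr
    have h0 : ∫ w : Metric.sphere (0 : E3) 1, fderiv ℝ f (x + (0 : ℝ) • (w : E3)) (w : E3)
        ∂((volume : Measure E3).toSphere) = 0 := by
      simp only [zero_smul, add_zero]
      exact integral_fderiv_centre_eq_zero f x
    rw [h0]
    ring
  · apply mul_left_cancel₀ hr
    linear_combination (-1 : ℝ) * hD

end Summit.FinalStateConjecture.FinalStateConjecture.Theorems.NecksCertifyTwoCap.Darboux

end
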